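import Literature.NumberTheory.LFunctions.XiHeatRayLaplace
import HarnessLib

/-!
# Strict monotonicity of `σ ↦ |𝒜_t(σ + iT)|` and Ki–Kim–Lee's theorem

Sixth and last file of the in-tree proof of `Literature.NumberTheory.LFunctions.ki_kim_lee_finite`
(Ki–Kim–Lee, Adv. Math. 222 (2009), Thm. 1.3: for every `t > 0` all but finitely many zeros of
`H_t` are real), discharged here as `Literature.NumberTheory.LFunctions.ki_kim_lee_finite_holds`.
Everything is proved; there are no new definitions (they live in `XiHeatRayWindow.lean`).

* `Literature.NumberTheory.LFunctions.norm_xiHeatRay_lt_of_laplace` — **one monotonicity step**: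
  with `δ = σ₂ − σ₁ > 0`, `𝒜(σ₂) = e^{κ_T δ}𝒜(σ₁) + E` where, by `XiHeatRayLaplace.lean`,
  `‖E‖ ≤ δ e^{ℓδ}(B n + ‖K‖ i)` and `‖𝒜(σ₁)‖ ≥ ‖K‖ m − 5B`; since `e^{ℓδ} − 1 ≥ e^{ℓδ} ℓδ/(1+ℓ)`,
  the numerical condition `(B n + ‖K‖ i)(1 + ℓ) < ℓ(‖K‖ m − 5B)` gives `‖𝒜(σ₁)‖ < ‖𝒜(σ₂)‖`.
* `Literature.NumberTheory.LFunctions.RegimeHyp.numerical_condition` — **the condition holds once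
  `u₀ = tℓ/2 ≥ 20`** (`0 < t ≤ 1/2`): then `ℓ ≥ 80`, `T = 2π e^{2ℓ} ≥ 1000`, `η_T ≤ 0.0864`,
  `η₂, η₃ ≤ 0.1`, `Y = u₀ − 5 ≥ 15`, and with `q = √(πt)`: `m ≥ 0.85 q`, `i ≤ 0.14 q`, while the
  strip term is `≤ 0.01 q ℓ` because `|ξ(σ+5+iT)|/‖K‖ ≤ exp(−9.95 u₀/t)` beats `T = 2π e^{4u₀/t}`.
* `Literature.NumberTheory.LFunctions.strictMonoOn_norm_xiHeatRay_of_le` — for `0 < t < 1/2` and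
  `T ≥ 2π e^{80/t}`, `σ ↦ |𝒜_t(σ + iT)|` is strictly increasing on `[0, 1]`;
* `Literature.NumberTheory.LFunctions.ki_kim_lee_finite_holds` — by
  `Literature.NumberTheory.LFunctions.ki_kim_lee_finite_of_strictMonoOn_xiHeatRay`.

The threshold `2π e^{80/t}` is explicit but astronomically large; Polymath 15, Thm. 1.5 (i) has
`x ≥ e^{C/t}` with an unspecified absolute `C`, and Ki–Kim–Lee's `t`-dependence is ineffective.

## References

* H. Ki, Y.-O. Kim, J. Lee, *On the de Bruijn–Newman constant*, Adv. Math. 222 (2009) 281–306,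
  Thm. 1.3.
* D. H. J. Polymath, Res. Math. Sci. 6 (2019) 31 (arXiv:1904.12438), Thm. 1.5 (i), §9.
-/

noncomputable section

open Complex Filter Set MeasureTheory
open scoped Real

namespace Literature.NumberTheory.LFunctions

/-- `n ≥ 0` for `t > 0`, `T ≥ 2π`. [folklore] -/
theorem xiInitRate_nonneg {t T : ℝ} (ht : 0 < t) (hT : 2 * π ≤ T) : 0 ≤ xiInitRate t T := by
  have := xiRayEll_nonneg hT
  unfold xiInitRate; positivity

/-- `e^x − 1 ≥ e^x · x/(1+x)` for `x ≥ 0` (i.e. `1 + x ≤ e^x`). [folklore] -/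
theorem exp_sub_one_ge {x : ℝ} (hx : 0 ≤ x) : Real.exp x * x / (1 + x) ≤ Real.exp x - 1 := by
  rw [div_le_iff₀ (by linarith)]
  nlinarith [Real.add_one_le_exp x, Real.exp_pos x]

/-- **One monotonicity step.** Let `LaplaceHyp t T σ₁` hold with `T ≥ 100`, and let
`σ₁ < σ₂ ≤ 1`. If the numerical condition
`(B n + ‖K‖ i)(1 + ℓ) < ℓ (‖K‖ m − 5B)` holds (`B = 300T|ξ(σ₁+5+iT)|`, `K` the Laplace scale at
`σ₁`, `m, i, n` as above), then `‖𝒜_t(σ₁ + iT)‖ < ‖𝒜_t(σ₂ + iT)‖`. Mechanism: with `δ = σ₂ − σ₁`,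
`𝒜(σ₂) = e^{κδ}𝒜(σ₁) + E`, `‖E‖ ≤ δ e^{ℓδ} (B n + ‖K‖ i)`, `‖𝒜(σ₁)‖ ≥ ‖K‖ m − 5B`, and
`e^{ℓδ} − 1 ≥ e^{ℓδ} ℓδ/(1 + ℓ)`. [cite: KiKimLee2009, Thm. 1.3] -/
theorem norm_xiHeatRay_lt_of_laplace {t T σ₁ σ₂ : ℝ} (h : LaplaceHyp t T σ₁) (hT : 100 ≤ T)
    (h12 : σ₁ < σ₂) (h1 : σ₂ ≤ 1)
    (hNC : (xiStripScale T σ₁ * xiInitRate t T + ‖xiLaplaceScale t T σ₁‖ * xiDiffInt t T σ₁) *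
        (1 + xiRayEll T) <
      xiRayEll T * (‖xiLaplaceScale t T σ₁‖ * xiMainLower t T σ₁ - 5 * xiStripScale T σ₁)) :
    ‖xiHeatRay t ((σ₁ : ℂ) + T * I)‖ < ‖xiHeatRay t ((σ₂ : ℂ) + T * I)‖ := by
  have ht := h.t_pos
  have hσ₁ : σ₁ ∈ Icc (0:ℝ) 1 := ⟨h.σ_nonneg, by linarith⟩
  have h2π : 2 * π ≤ T := by linarith [Real.pi_lt_d2]
  set δ := σ₂ - σ₁ with hδ
  have hδ0 : 0 < δ := by linarith
  have hδ1 : δ ≤ 1 := by linarith [h.σ_nonneg]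
  set ℓ := xiRayEll T with hℓ
  have hℓ0 : 0 ≤ ℓ := xiRayEll_nonneg h2π
  set B := xiStripScale T σ₁ with hB
  have hB0 : 0 ≤ B := xiStripScale_nonneg (by linarith) σ₁
  set K := ‖xiLaplaceScale t T σ₁‖ with hK
  have hK0 : 0 ≤ K := norm_nonneg _
  set n := xiInitRate t T with hn
  have hn0 : 0 ≤ n := xiInitRate_nonneg ht h2π
  set i := xiDiffInt t T σ₁ with hi
  set m := xiMainLower t T σ₁ with hm
  set R := B * n + K * i with hR
  set L := K * m - 5 * B with hL
  set g := Real.exp (ℓ * δ) with hg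
  have hg1 : 1 ≤ g := Real.one_le_exp (by positivity)
  set eκ : ℂ := cexp (xiLogDerivModel T * (δ : ℝ)) with heκ
  have hnorm_eκ : ‖eκ‖ = g := by
    rw [heκ, Complex.norm_exp]; congr 1; simp [xiLogDerivModel_eq_ell, hℓ]
  set F₁ := xiHeatRay t ((σ₁ : ℂ) + T * I) with hF₁
  set F₂ := xiHeatRay t ((σ₂ : ℂ) + T * I) with hF₂
  set E := F₂ - eκ * F₁ with hE
  -- the three estimates
  have hM : K * m ≤ ‖xiHeatRayMain t T σ₁‖ := norm_xiHeatRayMain_ge h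
  have hMd : ‖xiHeatRayMain t T σ₂ - eκ * xiHeatRayMain t T σ₁‖ ≤ g * δ * (K * i) :=
    norm_xiHeatRayMain_sub_le h h12.le hδ1
  have hNd : ‖xiHeatRayInit t T σ₂ - eκ * xiHeatRayInit t T σ₁‖ ≤ δ * g * B * n :=
    norm_xiHeatRayInit_sub_exp_mul_le ht hT h.σ_nonneg h12.le h1
  have hN1 : ‖xiHeatRayInit t T σ₁‖ ≤ 5 * B := norm_xiHeatRayInit_le ht hT hσ₁
  -- `‖E‖ ≤ δ g R`
  have hEeq : E = (xiHeatRayInit t T σ₂ - eκ * xiHeatRayInit t T σ₁) +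
      (xiHeatRayMain t T σ₂ - eκ * xiHeatRayMain t T σ₁) := by
    rw [hE, hF₁, hF₂, xiHeatRay_eq_init_add_main ht, xiHeatRay_eq_init_add_main ht]; ring
  have hEle : ‖E‖ ≤ δ * g * R := by
    rw [hEeq]
    refine (norm_add_le _ _).trans ?_
    have : δ * g * R = δ * g * B * n + g * δ * (K * i) := by rw [hR]; ring
    rw [this]
    exact add_le_add hNd hMd
  -- `‖F₁‖ ≥ L`
  have hF₁ge : L ≤ ‖F₁‖ := by
    have e : F₁ = xiHeatRayMain t T σ₁ + xiHeatRayInit t T σ₁ := by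
      rw [hF₁, xiHeatRay_eq_init_add_main ht, add_comm]
    rw [e]
    have := norm_sub_norm_le (xiHeatRayMain t T σ₁) (-xiHeatRayInit t T σ₁)
    rw [sub_neg_eq_add, norm_neg] at this
    linarith
  -- from the numerical condition: `ℓ > 0`, `L > 0`, `δ g R < (g − 1) L`
  have hR0 : 0 ≤ R := by
    have : 0 ≤ K * i := by
      -- `K i ≥ 0` since `‖M₂ − eκ M₁‖ ≤ g δ (K i)` with `g δ > 0`
      have h0 : 0 ≤ g * δ * (K * i) := (norm_nonneg _).trans hMd
      have hgδ : 0 < g * δ := by positivity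
      nlinarith
    positivity
  have hℓL : R * (1 + ℓ) < ℓ * L := hNC
  have hLpos : 0 < L := by
    by_contra hcon
    have hcon : L ≤ 0 := not_lt.mp hcon
    have : ℓ * L ≤ 0 := mul_nonpos_of_nonneg_of_nonpos hℓ0 hcon
    have : 0 ≤ R * (1 + ℓ) := by positivity
    linarith
  have hkey : δ * g * R < (g - 1) * L := by
    have h1' : g * (ℓ * δ) / (1 + ℓ * δ) ≤ g - 1 := exp_sub_one_ge (by positivity)
    have h2' : g * (ℓ * δ) / (1 + ℓ) ≤ g * (ℓ * δ) / (1 + ℓ * δ) := by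
      apply div_le_div_of_nonneg_left (by positivity) (by positivity)
      nlinarith
    have h3' : δ * g * R < g * (ℓ * δ) / (1 + ℓ) * L := by
      rw [div_mul_eq_mul_div, lt_div_iff₀ (by positivity)]
      have hgδ : 0 < g * δ := by positivity
      nlinarith
    calc δ * g * R < g * (ℓ * δ) / (1 + ℓ) * L := h3'
      _ ≤ (g - 1) * L := by
          have := h2'.trans h1'
          exact mul_le_mul_of_nonneg_right this hLpos.le
  -- conclude: `‖F₂‖ ≥ g ‖F₁‖ − ‖E‖ > ‖F₁‖`
  have hF₂ge : g * ‖F₁‖ - ‖E‖ ≤ ‖F₂‖ := by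
    have e : F₂ = eκ * F₁ + E := by rw [hE]; ring
    rw [e]
    have := norm_sub_norm_le (eκ * F₁) (-E)
    rw [sub_neg_eq_add, norm_neg, norm_mul, hnorm_eκ] at this
    linarith
  have hEF : ‖E‖ < (g - 1) * ‖F₁‖ := by
    calc ‖E‖ ≤ δ * g * R := hEle
      _ < (g - 1) * L := hkey
      _ ≤ (g - 1) * ‖F₁‖ := mul_le_mul_of_nonneg_left hF₁ge (by linarith)
  linarith

end Literature.NumberTheory.LFunctions

namespace Literature.NumberTheory.LFunctions

/-! ## Elementary numerical facts -/

/-- `e^{-1} ≤ 0.368`. [folklore] -/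
theorem exp_neg_one_le : Real.exp (-1) ≤ 0.368 := by
  have := Real.exp_neg_one_lt_d9; linarith

/-- `e^{-10} ≤ 0.001`. [folklore] -/
theorem exp_neg_ten_le : Real.exp (-10) ≤ 0.001 := by
  have h : Real.exp (-10) = Real.exp (-1) ^ 10 := by rw [← Real.exp_nat_mul]; norm_num
  rw [h]
  have h0 : 0 ≤ Real.exp (-1) := (Real.exp_pos _).le
  calc Real.exp (-1) ^ 10 ≤ (0.368 : ℝ) ^ 10 := pow_le_pow_left₀ h0 exp_neg_one_le 10
    _ ≤ 0.001 := by norm_num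

/-- `e^{-x} ≤ 0.001` for `x ≥ 10`. [folklore] -/
theorem exp_neg_le_of_ten_le {x : ℝ} (hx : 10 ≤ x) : Real.exp (-x) ≤ 0.001 :=
  (Real.exp_le_exp.2 (by linarith)).trans exp_neg_ten_le

/-- `e^{-38} ≤ 10⁻¹²`. [folklore] -/
theorem exp_neg_38_le : Real.exp (-38) ≤ 1e-12 := by
  have h : Real.exp (-38) = Real.exp (-1) ^ 38 := by rw [← Real.exp_nat_mul]; norm_num
  rw [h]
  have h0 : 0 ≤ Real.exp (-1) := (Real.exp_pos _).le
  calc Real.exp (-1) ^ 38 ≤ (0.368 : ℝ) ^ 38 := pow_le_pow_left₀ h0 exp_neg_one_le 38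
    _ ≤ 1e-12 := by norm_num

/-- `e^{x} ≤ 1/(1 − x)` for `x < 1` (from `1 − x ≤ e^{-x}`). [folklore] -/
theorem exp_le_one_div_one_sub {x : ℝ} (hx : x < 1) : Real.exp x ≤ 1 / (1 - x) := by
  have h := Real.add_one_le_exp (-x)
  rw [Real.exp_neg] at h
  rw [le_div_iff₀ (by linarith)]
  have := Real.exp_pos x
  calc Real.exp x * (1 - x) = Real.exp x * (-x + 1) := by ring
    _ ≤ Real.exp x * (Real.exp x)⁻¹ := by gcongr
    _ = 1 := mul_inv_cancel₀ this.ne'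

/-- `e^{-1/t} ≤ t` for `t > 0`. [folklore] -/
theorem exp_neg_inv_le {t : ℝ} (ht : 0 < t) : Real.exp (-(1 / t)) ≤ t := by
  have h := Real.add_one_le_exp (1 / t)
  have h1 : 1 / t ≤ Real.exp (1 / t) := by linarith
  rw [Real.exp_neg, inv_le_comm₀ (Real.exp_pos _) ht]
  calc t⁻¹ = 1 / t := (one_div t).symm
    _ ≤ _ := h1

/-- `√(c x) ≤ k √x` when `0 ≤ c ≤ k²`, `0 ≤ k`. [folklore] -/
theorem sqrt_mul_le_mul_sqrt {c k x : ℝ} (hc : 0 ≤ c) (hk : 0 ≤ k) (hck : c ≤ k ^ 2) :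
    Real.sqrt (c * x) ≤ k * Real.sqrt x := by
  rw [Real.sqrt_mul hc]
  gcongr
  exact Real.sqrt_le_iff.2 ⟨hk, hck⟩

/-! ## The regime `u₀ ≥ 20` -/

namespace RegimeHyp

variable {t T : ℝ} (h : RegimeHyp t T)
include h

/-- `s = u₀/t ≥ 40`. [folklore] -/
theorem forty_le : 40 ≤ xiLaplacePt t T / t := by
  rw [le_div_iff₀ h.t_pos]; nlinarith [h.laplacePt, h.t_le]

/-- `ℓ = 2 u₀ / t`. [folklore] -/
theorem ell_eq : xiRayEll T = 2 * (xiLaplacePt t T / t) := by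
  rw [xiRayEll_eq_laplacePt h.t_pos.ne']; ring

/-- `ℓ ≥ 80`. [folklore] -/
theorem eighty_le_ell : 80 ≤ xiRayEll T := by rw [h.ell_eq]; linarith [h.forty_le]

/-- `T = 2π e^{2ℓ}`. [folklore] -/
theorem T_eq : T = 2 * π * Real.exp (2 * xiRayEll T) := by
  have : 2 * xiRayEll T = Real.log (T / (2 * π)) := by rw [xiRayEll]; ring
  rw [this, Real.exp_log (by have := h.T_pos; positivity)]
  field_simp

/-- `T ≥ 2π (1 + 2ℓ + 2ℓ²)`; in particular `T` is huge. [folklore] -/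
theorem T_ge : 2 * π * (1 + 2 * xiRayEll T + (2 * xiRayEll T) ^ 2 / 2) ≤ T := by
  have hq := Real.quadratic_le_exp_of_nonneg (show 0 ≤ 2 * xiRayEll T by linarith [h.eighty_le_ell])
  calc _ ≤ 2 * π * Real.exp (2 * xiRayEll T) := by gcongr
    _ = T := h.T_eq.symm

/-- `T ≥ 1000`. [folklore] -/
theorem thousand_le : 1000 ≤ T := by
  have h1 := h.T_ge
  have hℓ := h.eighty_le_ell
  have hπ := Real.pi_gt_three
  nlinarith

/-- `T ≥ 100 (u₀ + 1)` (so all `O((σ + u₀)/T)` perturbations are `≤ 0.01`). [folklore] -/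
theorem laplacePt_le : 100 * (xiLaplacePt t T + 1) ≤ T := by
  have h1 := h.T_ge
  have hℓ := h.eighty_le_ell
  have hπ := Real.pi_gt_three
  have hu : xiLaplacePt t T ≤ xiRayEll T / 4 := by
    rw [xiLaplacePt]; nlinarith [h.t_le, h.t_pos]
  nlinarith

/-- `η_T ≤ 0.0864`. [folklore] -/
theorem rayErr_le : xiRayErr T ≤ 0.0864 := by
  rw [xiRayErr]
  have : 4 / T ≤ 4 / 1000 := div_le_div_of_nonneg_left (by norm_num) (by norm_num) h.thousand_le
  linarith

/-- `(σ + 2u₀ + 1)/(2T) ≤ 0.01` for `σ ≤ 1`. [folklore] -/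
theorem perturb_le {σ : ℝ} (hσ : σ ≤ 1) :
    (σ + xiLaplacePt t T + (xiLaplacePt t T - 5) + 1) / (2 * T) ≤ 0.01 := by
  have hT := h.T_pos
  rw [div_le_iff₀ (by positivity)]
  have := h.laplacePt_le
  linarith

/-- `η₂ ≤ 0.1`. [folklore] -/
theorem windowErr_le {σ : ℝ} (hσ : σ ≤ 1) : xiWindowErr t T σ ≤ 0.1 := by
  rw [xiWindowErr]
  have h1 := h.rayErr_le
  have h2 := h.perturb_le hσ
  have hT := h.T_pos
  have : (σ + xiLaplacePt t T + (xiLaplacePt t T - 5)) / (2 * T) ≤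
      (σ + xiLaplacePt t T + (xiLaplacePt t T - 5) + 1) / (2 * T) :=
    div_le_div_of_nonneg_right (by linarith) (by positivity)
  linarith

/-- `η₃ ≤ 0.1`. [folklore] -/
theorem windowErr'_le {σ : ℝ} (hσ : σ ≤ 1) : xiWindowErr' t T σ ≤ 0.1 := by
  rw [xiWindowErr']
  have h1 := h.rayErr_le
  have h2 := h.perturb_le hσ
  linarith

/-- The Laplace hypotheses hold in the regime, for every `σ ∈ [0, 1]`. [folklore] -/
theorem laplaceHyp {σ : ℝ} (h0 : 0 ≤ σ) (h1 : σ ≤ 1) : LaplaceHyp t T σ where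
  t_pos := h.t_pos
  five_le := by linarith [h.thousand_le]
  two_t_le := by linarith [h.thousand_le, h.t_le]
  σ_nonneg := h0
  σ_le_one := h1
  window := by
    have hη := h.rayErr_le
    have := h.laplacePt
    nlinarith [h.t_le, h.t_pos]
  c_le' := by
    have := h.laplacePt_le
    have := h.laplacePt
    linarith

end RegimeHyp

end Literature.NumberTheory.LFunctions

namespace Literature.NumberTheory.LFunctions

/-! ## Square roots against `q = √(πt)` -/

/-- `√(π·4t) = 2 √(πt)`. [folklore] -/
theorem sqrt_pi_mul_four_mul (t : ℝ) : Real.sqrt (π * (4 * t)) = 2 * Real.sqrt (π * t) := by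
  rw [show π * (4 * t) = 4 * (π * t) by ring, Real.sqrt_mul (by norm_num : (0:ℝ) ≤ 4),
    show (4 : ℝ) = 2 ^ 2 by norm_num, Real.sqrt_sq (by norm_num : (0:ℝ) ≤ 2)]

/-- `√(π·2t) ≤ 1.4143 √(πt)`. [folklore] -/
theorem sqrt_pi_mul_two_mul_le (t : ℝ) : Real.sqrt (π * (2 * t)) ≤ 1.4143 * Real.sqrt (π * t) := by
  rw [show π * (2 * t) = 2 * (π * t) by ring]
  exact sqrt_mul_le_mul_sqrt (by norm_num) (by norm_num) (by norm_num)

/-- `√(π·8t) ≤ 2.8286 √(πt)`. [folklore] -/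
theorem sqrt_pi_mul_eight_mul_le (t : ℝ) : Real.sqrt (π * (8 * t)) ≤ 2.8286 * Real.sqrt (π * t) := by
  rw [show π * (8 * t) = 8 * (π * t) by ring]
  exact sqrt_mul_le_mul_sqrt (by norm_num) (by norm_num) (by norm_num)

/-- `√(π·4t/3) ≤ 1.155 √(πt)`. [folklore] -/
theorem sqrt_pi_mul_four_thirds_mul_le (t : ℝ) : Real.sqrt (π * (4 * t / 3)) ≤ 1.155 * Real.sqrt (π * t) := by
  rw [show π * (4 * t / 3) = 4 / 3 * (π * t) by ring]
  exact sqrt_mul_le_mul_sqrt (by norm_num) (by norm_num) (by norm_num)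

/-- `t ≤ 0.41 √(πt)` for `0 ≤ t ≤ 1/2` (`t² ≤ 0.1681 π t` as `0.1681 π > 1/2`). [folklore] -/
theorem le_mul_sqrt_pi_mul {t : ℝ} (ht0 : 0 ≤ t) (ht : t ≤ 1 / 2) : t ≤ 0.41 * Real.sqrt (π * t) := by
  have hq : 0 ≤ 0.41 * Real.sqrt (π * t) := by positivity
  rw [← pow_le_pow_iff_left₀ ht0 hq two_ne_zero, mul_pow, Real.sq_sqrt (by positivity)]
  nlinarith [Real.pi_gt_three]

/-- `0 < √(πt)` for `t > 0`. [folklore] -/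
theorem sqrt_pi_mul_pos {t : ℝ} (ht : 0 < t) : 0 < Real.sqrt (π * t) := Real.sqrt_pos.2 (by positivity)

namespace RegimeHyp

variable {t T : ℝ} (h : RegimeHyp t T)
include h

/-- `Y = u₀ − 5 ≥ 15`, hence `Y²/(8t) ≥ 10`. [folklore] -/
theorem ten_le_Y_sq_div : 10 ≤ (xiLaplacePt t T - 5) ^ 2 / (8 * t) := by
  have ht := h.t_pos
  rw [le_div_iff₀ (by positivity)]
  nlinarith [h.laplacePt, h.t_le]

/-- The three Gaussian tails are `≤ 0.001`. [folklore] -/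
theorem tails_le :
    Real.exp (-((xiLaplacePt t T - 5) ^ 2 / (4 * t))) ≤ 0.001 ∧
    Real.exp (-((xiLaplacePt t T - 5) ^ 2 / (2 * t))) ≤ 0.001 ∧
    Real.exp (-((xiLaplacePt t T - 5) ^ 2 / (8 * t))) ≤ 0.001 := by
  have ht := h.t_pos
  have h8 := h.ten_le_Y_sq_div
  have hY2 : 0 ≤ (xiLaplacePt t T - 5) ^ 2 := sq_nonneg _
  have h4 : (xiLaplacePt t T - 5) ^ 2 / (8 * t) ≤ (xiLaplacePt t T - 5) ^ 2 / (4 * t) :=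
    div_le_div_of_nonneg_left hY2 (by positivity) (by linarith)
  have h2 : (xiLaplacePt t T - 5) ^ 2 / (8 * t) ≤ (xiLaplacePt t T - 5) ^ 2 / (2 * t) :=
    div_le_div_of_nonneg_left hY2 (by positivity) (by linarith)
  exact ⟨exp_neg_le_of_ten_le (by linarith), exp_neg_le_of_ten_le (by linarith), exp_neg_le_of_ten_le h8⟩

/-- **`m ≥ 0.85 √(πt)`** in the regime (`σ ∈ [0,1]`). [folklore] -/
theorem mainLower_ge {σ : ℝ} (h0 : 0 ≤ σ) (h1 : σ ≤ 1) : 0.85 * Real.sqrt (π * t) ≤ xiMainLower t T σ := by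
  have ht := h.t_pos
  set q := Real.sqrt (π * t) with hq
  have hq0 : 0 < q := sqrt_pi_mul_pos ht
  have hη₂ := h.windowErr_le h1
  have hη₂0 : 0 ≤ xiWindowErr t T σ := (h.laplaceHyp h0 h1).windowErr_nonneg
  obtain ⟨t4, t2, -⟩ := h.tails_le
  -- (m1) the main Gaussian: `e^{-π²t/64} ≥ 0.92`
  have m1 : 0.92 * q ≤ q * Real.exp (-(π ^ 2 * t / 64)) := by
    rw [mul_comm]
    refine mul_le_mul_of_nonneg_left ?_ hq0.le
    have hb := Real.add_one_le_exp (-(π ^ 2 * t / 64))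
    have : π ^ 2 * t / 64 ≤ 0.08 := by
      have hπ : π ^ 2 < 3.15 ^ 2 := by
        have := Real.pi_lt_d2; have := Real.pi_pos; gcongr
      nlinarith [h.t_le]
    linarith
  -- (m2) `η₂ e^{η₂² t} (4t/3) ≤ 0.055 q`
  have m2 : xiWindowErr t T σ * Real.exp (xiWindowErr t T σ ^ 2 * t) * (4 * t / 3) ≤ 0.055 * q := by
    have he : Real.exp (xiWindowErr t T σ ^ 2 * t) ≤ 1.006 := by
      have : xiWindowErr t T σ ^ 2 * t ≤ 0.005 := by
        have : xiWindowErr t T σ ^ 2 ≤ 0.1 ^ 2 := pow_le_pow_left₀ hη₂0 hη₂ 2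
        nlinarith [h.t_le]
      calc Real.exp (xiWindowErr t T σ ^ 2 * t) ≤ Real.exp 0.005 := Real.exp_le_exp.2 this
        _ ≤ 1 / (1 - 0.005) := exp_le_one_div_one_sub (by norm_num)
        _ ≤ 1.006 := by norm_num
    have htq : t ≤ 0.41 * q := le_mul_sqrt_pi_mul ht.le h.t_le
    calc xiWindowErr t T σ * Real.exp (xiWindowErr t T σ ^ 2 * t) * (4 * t / 3)
        ≤ 0.1 * 1.006 * (4 * (0.41 * q) / 3) := by gcongr
      _ ≤ 0.055 * q := by nlinarith
  -- (m3), (m4) the tails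
  have m3 : 2 * Real.exp (-((xiLaplacePt t T - 5) ^ 2 / (4 * t))) * Real.sqrt (π * (4 * t)) ≤ 0.004 * q := by
    rw [sqrt_pi_mul_four_mul]
    calc 2 * Real.exp (-((xiLaplacePt t T - 5) ^ 2 / (4 * t))) * (2 * q) ≤ 2 * 0.001 * (2 * q) := by gcongr
      _ = 0.004 * q := by ring
  have m4 : Real.exp (-((xiLaplacePt t T - 5) ^ 2 / (2 * t))) * Real.sqrt (π * (2 * t)) ≤ 0.0015 * q := by
    calc _ ≤ 0.001 * (1.4143 * q) :=
          mul_le_mul t2 (sqrt_pi_mul_two_mul_le t) (Real.sqrt_nonneg _) (by norm_num)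
      _ ≤ 0.0015 * q := by nlinarith
  rw [xiMainLower]
  linarith

/-- **`i ≤ 0.14 √(πt)`** in the regime (`σ ∈ [0,1]`). [folklore] -/
theorem diffInt_le {σ : ℝ} (h0 : 0 ≤ σ) (h1 : σ ≤ 1) : xiDiffInt t T σ ≤ 0.14 * Real.sqrt (π * t) := by
  have ht := h.t_pos
  set q := Real.sqrt (π * t) with hq
  have hq0 : 0 < q := sqrt_pi_mul_pos ht
  have hη₂ := h.windowErr_le h1
  have hη₂0 : 0 ≤ xiWindowErr t T σ := (h.laplaceHyp h0 h1).windowErr_nonneg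
  have hη₃ := h.windowErr'_le h1
  have hη₃0 : 0 ≤ xiWindowErr' t T σ := (h.laplaceHyp h0 h1).windowErr'_nonneg
  obtain ⟨-, -, t8⟩ := h.tails_le
  -- (i1)
  have i1 : xiWindowErr' t T σ * Real.exp (xiWindowErr' t T σ + xiWindowErr t T σ ^ 2 * t) *
      Real.sqrt (π * (4 * t / 3)) ≤ 0.13 * q := by
    have he : Real.exp (xiWindowErr' t T σ + xiWindowErr t T σ ^ 2 * t) ≤ 1.12 := by
      have : xiWindowErr' t T σ + xiWindowErr t T σ ^ 2 * t ≤ 0.105 := by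
        have : xiWindowErr t T σ ^ 2 ≤ 0.1 ^ 2 := pow_le_pow_left₀ hη₂0 hη₂ 2
        nlinarith [h.t_le]
      calc _ ≤ Real.exp 0.105 := Real.exp_le_exp.2 this
        _ ≤ 1 / (1 - 0.105) := exp_le_one_div_one_sub (by norm_num)
        _ ≤ 1.12 := by norm_num
    calc _ ≤ 0.1 * 1.12 * (1.155 * q) := by
          gcongr
          exact sqrt_pi_mul_four_thirds_mul_le t
      _ ≤ 0.13 * q := by nlinarith
  -- (i2)
  have i2 : Real.exp (2 * xiRayErr T + 2 - (xiLaplacePt t T - 5) ^ 2 / (8 * t)) * Real.sqrt (π * (8 * t)) ≤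
      0.003 * q := by
    have he : Real.exp (2 * xiRayErr T + 2 - (xiLaplacePt t T - 5) ^ 2 / (8 * t)) ≤ 0.001 := by
      have h8 := h.ten_le_Y_sq_div
      have hη := h.rayErr_le
      have : 2 * xiRayErr T + 2 - (xiLaplacePt t T - 5) ^ 2 / (8 * t) ≤ -10 := by
        have : 20 ≤ (xiLaplacePt t T - 5) ^ 2 / (8 * t) := by
          rw [le_div_iff₀ (by positivity)]; nlinarith [h.laplacePt, h.t_le]
        linarith
      calc _ ≤ Real.exp (-10) := Real.exp_le_exp.2 this
        _ ≤ 0.001 := exp_neg_ten_le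
    calc _ ≤ 0.001 * (2.8286 * q) :=
          mul_le_mul he (sqrt_pi_mul_eight_mul_le t) (Real.sqrt_nonneg _) (by norm_num)
      _ ≤ 0.003 * q := by nlinarith
  rw [xiDiffInt]
  linarith

/-! ## The strip term -/

/-- The strip rate `b = 300 T exp(u₀²/t − (u₀ − 5)(ℓ − η_T − (σ + u₀)/(2T)))` with `B ≤ ‖K‖ b`. [folklore] -/
theorem stripScale_le {σ : ℝ} (h0 : 0 ≤ σ) :
    xiStripScale T σ ≤ ‖xiLaplaceScale t T σ‖ * (300 * T *
      Real.exp (xiLaplacePt t T ^ 2 / t - (xiLaplacePt t T - 5) *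
        (xiRayEll T - xiRayErr T - (σ + xiLaplacePt t T) / (2 * T)))) := by
  have hT := h.T_pos
  have hx := norm_riemannXi_five_le_laplace (t := t) (σ := σ) (by linarith [h.thousand_le]) h0
    (by linarith [h.laplacePt])
  rw [xiStripScale]
  calc 300 * T * ‖riemannXi (((σ + 5 : ℝ) : ℂ) + T * I)‖ ≤ 300 * T * (‖xiLaplaceScale t T σ‖ *
      Real.exp (xiLaplacePt t T ^ 2 / t - (xiLaplacePt t T - 5) *
        (xiRayEll T - xiRayErr T - (σ + xiLaplacePt t T) / (2 * T)))) := by gcongr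
    _ = _ := by ring

/-- The exponent of the strip rate: `u₀²/t − (u₀−5)(ℓ − η_T − c/(2T)) ≤ −9.95 s`, `s = u₀/t`. [folklore] -/
theorem strip_exponent_le {σ : ℝ} (h0 : 0 ≤ σ) (h1 : σ ≤ 1) :
    xiLaplacePt t T ^ 2 / t - (xiLaplacePt t T - 5) *
        (xiRayEll T - xiRayErr T - (σ + xiLaplacePt t T) / (2 * T)) ≤
      -9.95 * (xiLaplacePt t T / t) := by
  have ht := h.t_pos
  have hT := h.T_pos
  set u₀ := xiLaplacePt t T with hu₀
  set s := u₀ / t with hs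
  have hu20 : 20 ≤ u₀ := h.laplacePt
  have hℓ : xiRayEll T = 2 * s := h.ell_eq
  have hη0 : 0 ≤ xiRayErr T := xiRayErr_nonneg hT
  have hη : xiRayErr T ≤ 0.0864 := h.rayErr_le
  have hc0 : 0 ≤ (σ + u₀) / (2 * T) := by positivity
  have hc : (σ + u₀) / (2 * T) ≤ 0.01 := by
    have := h.perturb_le h1
    have : (σ + u₀) / (2 * T) ≤ (σ + xiLaplacePt t T + (xiLaplacePt t T - 5) + 1) / (2 * T) :=
      div_le_div_of_nonneg_right (by linarith) (by positivity)
    linarith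
  have hu₀s : u₀ = t * s := by rw [hs]; field_simp
  have hsq : u₀ ^ 2 / t = u₀ * s := by rw [hs]; field_simp
  rw [hsq, hℓ]
  set A := xiRayErr T + (σ + u₀) / (2 * T) with hA
  have hA0 : 0 ≤ A := by positivity
  have hA1 : A ≤ 0.1 := by linarith
  have hs0 : 0 ≤ s := by rw [hs]; positivity
  have e : u₀ * s - (u₀ - 5) * (2 * s - xiRayErr T - (σ + u₀) / (2 * T)) =
      -(u₀ - 10) * s + A * (u₀ - 5) := by rw [hA]; ring
  rw [e]
  have h1' : A * (u₀ - 5) ≤ 0.1 * u₀ := by nlinarith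
  have h2' : 0.1 * u₀ ≤ 0.05 * s := by rw [hu₀s]; nlinarith [h.t_le]
  nlinarith

/-- **The strip term is negligible**: with `b` the strip rate,
`b (n (1 + ℓ) + 5ℓ) ≤ 0.01 √(πt) ℓ`. [folklore] -/
theorem strip_term_le {σ : ℝ} (h0 : 0 ≤ σ) (h1 : σ ≤ 1) :
    300 * T * Real.exp (xiLaplacePt t T ^ 2 / t - (xiLaplacePt t T - 5) *
        (xiRayEll T - xiRayErr T - (σ + xiLaplacePt t T) / (2 * T))) *
      (xiInitRate t T * (1 + xiRayEll T) + 5 * xiRayEll T) ≤ 0.01 * Real.sqrt (π * t) * xiRayEll T := by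
  have ht := h.t_pos
  have hT := h.T_pos
  have hq0 : 0 < Real.sqrt (π * t) := sqrt_pi_mul_pos ht
  have hu20 : 20 ≤ xiLaplacePt t T := h.laplacePt
  have hs40 : 40 ≤ xiLaplacePt t T / t := h.forty_le
  have hℓ : xiRayEll T = 2 * (xiLaplacePt t T / t) := h.ell_eq
  have hℓ0 : 0 ≤ xiRayEll T := by linarith
  have hE := h.strip_exponent_le h0 h1
  -- `n ≤ 30.6 s`
  have hn : xiInitRate t T ≤ 30.6 * (xiLaplacePt t T / t) := by
    rw [xiInitRate, hℓ]
    have h1t : 60 / t ≤ 3 * (xiLaplacePt t T / t) := by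
      rw [div_le_iff₀ ht, mul_assoc, div_mul_cancel₀ _ ht.ne']; linarith
    have he : Real.exp 1 ≤ 2.72 := by have := Real.exp_one_lt_d9; linarith
    have : 5 * Real.exp 1 * (2 * (xiLaplacePt t T / t) + 1) ≤ 5 * 2.72 * (2 * (xiLaplacePt t T / t) + 1) := by
      gcongr
    nlinarith
  have hn0 : 0 ≤ xiInitRate t T := xiInitRate_nonneg ht (by linarith [h.thousand_le, Real.pi_lt_d2])
  -- `n(1+ℓ) + 5ℓ ≤ 31.2 s ℓ`
  have hbr : xiInitRate t T * (1 + xiRayEll T) + 5 * xiRayEll T ≤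
      31.2 * (xiLaplacePt t T / t) * xiRayEll T := by
    rw [hℓ]; nlinarith
  -- `T e^{E} ≤ 2π e^{-5.95 s}`
  have hexp : T * Real.exp (xiLaplacePt t T ^ 2 / t - (xiLaplacePt t T - 5) *
      (xiRayEll T - xiRayErr T - (σ + xiLaplacePt t T) / (2 * T))) ≤
      2 * π * Real.exp (-5.95 * (xiLaplacePt t T / t)) := by
    have hTe : T = 2 * π * Real.exp (2 * xiRayEll T) := h.T_eq
    calc T * Real.exp (xiLaplacePt t T ^ 2 / t - (xiLaplacePt t T - 5) *
          (xiRayEll T - xiRayErr T - (σ + xiLaplacePt t T) / (2 * T)))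
        = 2 * π * Real.exp (2 * xiRayEll T + (xiLaplacePt t T ^ 2 / t - (xiLaplacePt t T - 5) *
          (xiRayEll T - xiRayErr T - (σ + xiLaplacePt t T) / (2 * T)))) := by
          rw [Real.exp_add, ← mul_assoc, ← hTe]
      _ ≤ 2 * π * Real.exp (-5.95 * (xiLaplacePt t T / t)) := by
          gcongr
          have h2ℓ : 2 * xiRayEll T = 4 * (xiLaplacePt t T / t) := by rw [hℓ]; ring
          linarith
  -- `s e^{-5.95 s} ≤ 0.368 · 10⁻¹² · e^{-s}`
  have hse : (xiLaplacePt t T / t) * Real.exp (-5.95 * (xiLaplacePt t T / t)) ≤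
      0.368 * 1e-12 * Real.exp (-(xiLaplacePt t T / t)) := by
    have e : Real.exp (-5.95 * (xiLaplacePt t T / t)) = Real.exp (-(xiLaplacePt t T / t)) *
        Real.exp (-3.95 * (xiLaplacePt t T / t)) * Real.exp (-(xiLaplacePt t T / t)) := by
      rw [← Real.exp_add, ← Real.exp_add]; ring_nf
    rw [e, ← mul_assoc, ← mul_assoc]
    gcongr
    · calc (xiLaplacePt t T / t) * Real.exp (-(xiLaplacePt t T / t)) ≤ Real.exp (-1) :=
          Real.mul_exp_neg_le_exp_neg_one _
        _ ≤ 0.368 := exp_neg_one_le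
    · calc Real.exp (-3.95 * (xiLaplacePt t T / t)) ≤ Real.exp (-38) := Real.exp_le_exp.2 (by linarith)
        _ ≤ 1e-12 := exp_neg_38_le
  -- `e^{-s} ≤ t ≤ 0.41 q`
  have hes : Real.exp (-(xiLaplacePt t T / t)) ≤ 0.41 * Real.sqrt (π * t) := by
    have h1s : 1 / t ≤ xiLaplacePt t T / t := div_le_div_of_nonneg_right (by linarith) ht.le
    calc Real.exp (-(xiLaplacePt t T / t)) ≤ Real.exp (-(1 / t)) := Real.exp_le_exp.2 (by linarith)
      _ ≤ t := exp_neg_inv_le ht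
      _ ≤ 0.41 * Real.sqrt (π * t) := le_mul_sqrt_pi_mul ht.le h.t_le
  calc 300 * T * Real.exp (xiLaplacePt t T ^ 2 / t - (xiLaplacePt t T - 5) *
        (xiRayEll T - xiRayErr T - (σ + xiLaplacePt t T) / (2 * T))) *
        (xiInitRate t T * (1 + xiRayEll T) + 5 * xiRayEll T)
      ≤ 300 * T * Real.exp (xiLaplacePt t T ^ 2 / t - (xiLaplacePt t T - 5) *
        (xiRayEll T - xiRayErr T - (σ + xiLaplacePt t T) / (2 * T))) *
        (31.2 * (xiLaplacePt t T / t) * xiRayEll T) := by gcongr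
    _ = 300 * 31.2 * (T * Real.exp (xiLaplacePt t T ^ 2 / t - (xiLaplacePt t T - 5) *
        (xiRayEll T - xiRayErr T - (σ + xiLaplacePt t T) / (2 * T)))) * (xiLaplacePt t T / t) * xiRayEll T := by
        ring
    _ ≤ 300 * 31.2 * (2 * π * Real.exp (-5.95 * (xiLaplacePt t T / t))) * (xiLaplacePt t T / t) *
        xiRayEll T := by gcongr
    _ = 600 * 31.2 * π * ((xiLaplacePt t T / t) * Real.exp (-5.95 * (xiLaplacePt t T / t))) * xiRayEll T := by
        ring
    _ ≤ 600 * 31.2 * π * (0.368 * 1e-12 * Real.exp (-(xiLaplacePt t T / t))) * xiRayEll T := by gcongr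
    _ ≤ 600 * 31.2 * π * (0.368 * 1e-12 * (0.41 * Real.sqrt (π * t))) * xiRayEll T := by gcongr
    _ ≤ 0.01 * Real.sqrt (π * t) * xiRayEll T := by
        have hπ := Real.pi_lt_d2
        refine mul_le_mul_of_nonneg_right ?_ hℓ0
        nlinarith

end RegimeHyp

end Literature.NumberTheory.LFunctions

namespace Literature.NumberTheory.LFunctions

namespace RegimeHyp

variable {t T : ℝ} (h : RegimeHyp t T)
include h

/-- **The numerical condition of `norm_xiHeatRay_lt_of_laplace` holds in the regime**:
`(B n + ‖K‖ i)(1 + ℓ) < ℓ (‖K‖ m − 5B)` for every `σ ∈ [0,1]`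
(`i ≤ 0.14 q`, `m ≥ 0.85 q`, `B ≤ ‖K‖ b` with `b (n(1+ℓ) + 5ℓ) ≤ 0.01 q ℓ`, `q = √(πt)`, `ℓ ≥ 80`). [folklore] -/
theorem numerical_condition {σ : ℝ} (h0 : 0 ≤ σ) (h1 : σ ≤ 1) :
    (xiStripScale T σ * xiInitRate t T + ‖xiLaplaceScale t T σ‖ * xiDiffInt t T σ) * (1 + xiRayEll T) <
      xiRayEll T * (‖xiLaplaceScale t T σ‖ * xiMainLower t T σ - 5 * xiStripScale T σ) := by
  have ht := h.t_pos
  have hT := h.T_pos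
  set q := Real.sqrt (π * t) with hq
  have hq0 : 0 < q := sqrt_pi_mul_pos ht
  set ℓ := xiRayEll T with hℓ
  have hℓ80 : 80 ≤ ℓ := h.eighty_le_ell
  set K := ‖xiLaplaceScale t T σ‖ with hK
  have hK0 : 0 < K := norm_pos_iff.2 (xiLaplaceScale_ne_zero (by linarith [h.laplacePt]))
  set B := xiStripScale T σ with hB
  have hB0 : 0 ≤ B := xiStripScale_nonneg hT.le σ
  set n := xiInitRate t T with hn
  have hn0 : 0 ≤ n := xiInitRate_nonneg ht (by linarith [h.thousand_le, Real.pi_lt_d2])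
  set i := xiDiffInt t T σ with hi
  set m := xiMainLower t T σ with hm
  set b := 300 * T * Real.exp (xiLaplacePt t T ^ 2 / t - (xiLaplacePt t T - 5) *
        (xiRayEll T - xiRayErr T - (σ + xiLaplacePt t T) / (2 * T))) with hb
  have hb0 : 0 ≤ b := by positivity
  have hBb : B ≤ K * b := by have := h.stripScale_le h0; simpa [hB, hK, hb, mul_assoc] using this
  have hi' : i ≤ 0.14 * q := h.diffInt_le h0 h1
  have hm' : 0.85 * q ≤ m := h.mainLower_ge h0 h1
  have hx : b * (n * (1 + ℓ) + 5 * ℓ) ≤ 0.01 * q * ℓ := h.strip_term_le h0 h1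
  -- reduce to `b(n(1+ℓ) + 5ℓ) + i(1+ℓ) < ℓ m`
  have key : b * (n * (1 + ℓ) + 5 * ℓ) + i * (1 + ℓ) < ℓ * m := by
    have h1ℓ : 1 + ℓ ≤ 1.0125 * ℓ := by linarith
    have hi2 : i * (1 + ℓ) ≤ 0.14 * q * (1.0125 * ℓ) := by
      calc i * (1 + ℓ) ≤ 0.14 * q * (1 + ℓ) := mul_le_mul_of_nonneg_right hi' (by linarith)
        _ ≤ 0.14 * q * (1.0125 * ℓ) := mul_le_mul_of_nonneg_left h1ℓ (by positivity)
    have hm2 : ℓ * (0.85 * q) ≤ ℓ * m := mul_le_mul_of_nonneg_left hm' (by linarith)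
    nlinarith
  calc (B * n + K * i) * (1 + ℓ) ≤ (K * b * n + K * i) * (1 + ℓ) := by gcongr
    _ = K * (b * (n * (1 + ℓ)) + i * (1 + ℓ)) := by ring
    _ < K * (ℓ * m - 5 * b * ℓ) := by
        refine mul_lt_mul_of_pos_left ?_ hK0
        nlinarith
    _ = ℓ * (K * m - 5 * (K * b)) := by ring
    _ ≤ ℓ * (K * m - 5 * B) := by gcongr

/-- **Strict monotonicity in the regime**: if `0 < t ≤ 1/2`, `T > 0` and `u₀ ≥ 20`, then
`σ ↦ |𝒜_t(σ + iT)|` is strictly increasing on `[0, 1]`. [cite: KiKimLee2009, Thm. 1.3] -/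
theorem strictMonoOn_norm_xiHeatRay :
    StrictMonoOn (fun σ : ℝ ↦ ‖xiHeatRay t ((σ : ℂ) + T * I)‖) (Icc 0 1) := by
  intro σ₁ hσ₁ σ₂ hσ₂ hlt
  exact norm_xiHeatRay_lt_of_laplace (h.laplaceHyp hσ₁.1 hσ₁.2) (by linarith [h.thousand_le]) hlt hσ₂.2
    (h.numerical_condition hσ₁.1 hσ₁.2)

end RegimeHyp

/-- **Threshold form**: for `0 < t < 1/2` and `T ≥ 2π e^{80/t}` (so that `u₀ = t ℓ_T/2 ≥ 20`),
`σ ↦ |𝒜_t(σ + iT)|` is strictly increasing on `[0, 1]`. [cite: KiKimLee2009, Thm. 1.3] -/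
theorem strictMonoOn_norm_xiHeatRay_of_le {t T : ℝ} (ht0 : 0 < t) (ht : t < 1 / 2)
    (hT : 2 * π * Real.exp (80 / t) ≤ T) :
    StrictMonoOn (fun σ : ℝ ↦ ‖xiHeatRay t ((σ : ℂ) + T * I)‖) (Icc 0 1) := by
  have hπ := Real.pi_pos
  have hT0 : 0 < T := lt_of_lt_of_le (by positivity) hT
  have hlog : 80 / t ≤ Real.log (T / (2 * π)) := by
    rw [← Real.log_exp (80 / t)]
    exact Real.log_le_log (Real.exp_pos _) (by rw [le_div_iff₀ (by positivity)]; linarith)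
  have hu₀ : 20 ≤ xiLaplacePt t T := by
    rw [xiLaplacePt, xiRayEll]
    have : t * (80 / t) = 80 := by field_simp
    nlinarith
  exact (RegimeHyp.mk ht0 ht.le hT0 hu₀).strictMonoOn_norm_xiHeatRay

/-- **Ki–Kim–Lee's theorem** (Adv. Math. 222 (2009), Thm. 1.3, reality part): for every `t > 0`
all but finitely many zeros of `H_t` are real, in the form of the named fact
`Literature.NumberTheory.LFunctions.ki_kim_lee_finite`: for every `t > 0` there is `T` such that
every zero `z` of `H_t` with `|Re z| ≥ T` is real. In-tree proof: the Hermite–Biehler reduction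
`Literature.NumberTheory.LFunctions.ki_kim_lee_finite_of_strictMonoOn_xiHeatRay` (heat-kernel
representation `8√(πt) H_t(z) = 𝒜_t(s) + 𝒜_t(1−s)`) and the strict monotonicity of
`σ ↦ |𝒜_t(σ + iT)|` for `T ≥ 2π e^{80/t}` (Laplace's method on the ray). [cite: KiKimLee2009, Thm. 1.3] -/
theorem ki_kim_lee_finite_holds : ki_kim_lee_finite :=
  ki_kim_lee_finite_of_strictMonoOn_xiHeatRay fun t ht0 ht ↦
    ⟨2 * π * Real.exp (80 / t), fun _ hT ↦ strictMonoOn_norm_xiHeatRay_of_le ht0 ht hT⟩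

end Literature.NumberTheory.LFunctions

end
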